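import Mathlib
import HarnessLib
import HarnessLib.Audit
import Summits.QuantumFields.Statement

/-!
Route: HeavyThresholdBridge

CLOSED (superseded) 2026-08-15T14:02:07Z by planner-plan-QuantumFields-QCD-0 — reason: superseded:route-QuantumFields-HeavyThresholdYMBridge — superseded by route-QuantumFields-HeavyThresholdYMBridge — note: Duplicate thesis discovered after open: plancard unit opened route-QuantumFields-HeavyThresholdYMBridge (13:33Z) from the SAME spine card heavy-threshold-robust-ym-bridge four minutes before this survey route (13:37Z). Same mechanism (threshold reading + scale-wise constructive decoupling + robust S. The file is kept as the record of this route; refuted decls are indexed as negative knowledge (`ledger negatives`).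

# Route HeavyThresholdBridge — all quarks above the threshold — robust SU(3) Yang–Mills gap plus
scale-wise constructive decoupling gives QCD as rendered

It suffices to show X := SU3YMGapAF ∧ DecouplingBridge ∧ ContinuumPackage. In words: (a) SU(3)
lattice Yang–Mills with
Wilson's action has a uniform lattice mass gap in physical units along EVERY asymptotically free
(N_f = 0 two-loop) bare-coupling
trajectory; (b) DECOUPLING BRIDGE: (a) implies the lattice half of heavy QCD — one mass-independent
regularisation `reg`
(two-loop asymptotic scaling, leading-log `HasMassScaling`) and a threshold M₀ such that for every
tuple of renormalised masses
above M₀ lattice QCD with N_f = 2, 3 Wilson quarks has a uniform lattice gap `HasLatticeMassGap Δ`;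
(c) CONTINUUM PACKAGE: the
lattice half implies the full threshold statement `HeavyQCD` (OS data along the same sequence,
E0–E4, non-trivial non-Gaussian
glue, non-decoupled flavour-changing pseudoscalars, `HasMassGap Δ`). The audited reading of `QCDOf`
(docstring of the Statement:
the flavour-blind offset in `m_crit` is witness data) makes `HeavyQCD → QCD` a provable support
lemma (`ThresholdShift`, proved in
the planner's Sketch.lean by shifting `m_crit(k) ↦ m_crit(k) + a_k M₀/Z_m(k)`). Cards realised:
heavy-threshold-robust-ym-bridge
(spine: (b)), arzela-ascoli-in-the-quark-mass and quarks-add-no-infrared-clause (the two halves of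
(c)).
Lean: `SU3YMGapAF ∧ DecouplingBridge ∧ ContinuumPackage`

## Assembly
Pure logic (elaborated rc 0 in Sketch.lean as `fun h1 h2 h3 h4 => h4 (h3 (h2 h1))`): SU3YMGapAF and
DecouplingBridge give
HeavyLatticeGap; ContinuumPackage turns it into HeavyQCD; ThresholdShift gives `QCD = QCDOf 2 ∧
QCDOf 3`. The mechanism lives in
the two implication cruxes; the Yang–Mills input is the one standalone conjecture.

Rationale: WHY THIS LINE. The statement quantifies `∃ reg, ∀ m > 0` with the additive mass renormalisation
`m_crit(k)` as witness data, so (audit g7) it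
asserts QCD for all mass SPLITTINGS above a witness-chosen common offset M₀; choosing M₀ ≫ Λ puts
every quark far above the QCD
scale while keeping it light at the cutoff. In that regime the non-perturbative content of
Appelquist–Carazzone decoupling
(doi:10.1103/physrevd.11.2856) is exactly what a Bałaban-type block renormalisation group with block
fermions would prove
(Balaban1988Convergent, Balaban1989LargeFieldII for the gauge field; Bałaban–O'Carroll–Schor
doi:10.1007/bf01257414 and
Dimock2022QED3 for fermions; GawedzkiKupiainenMasslessLattice1985 for tuning a critical bare mass
inside a flow): from a⁻¹ down
to M₀ the quarks only renormalise the coupling (this is where `betaCoeff₀ N_f` and `HasMassScaling`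
live), below M₀ the blocked
Dirac operator is massive in block units and integrates out into a small quasi-local gauge-invariant
effective action, leaving
SU(3) Yang–Mills on an N_f = 0 asymptotic-scaling trajectory with Λ_YM = Λ (M₀/Λ)^{2N_f/33}(1+o(1)).
Imported areas: constructive
RG (Bałaban, Dimock), heavy-quark/decoupling effective field theory (the explicit dictionary: RGI
quark mass ↦ block scale,
quark loops above M₀ ↦ shift of b₀, sea below M₀ ↦ quasi-local perturbation of norm O(g²(M₀)) +
(Λ_block/M₀)^c), and the
Osterwalder–Seiler/Lüscher transfer-matrix framework (OsterwalderSeiler1978, Luscher1977) for the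
packaging. What the line does
that nothing on the ledger does: it is the FIRST route on QuantumFields/QCD (no Theses, 0 negatives
at filing) and it isolates
the QCD-specific work (fermionic UV flow, heavy integration, species clauses) from the Yang–Mills
gap, which enters as ONE shared
typed item (`SU3YMGapAF`) that Yang–Mills-side routes can attach to.

RANKED CRUXES. #0 HeavyQCD (target) — the threshold form of the conjunct: for N_f = 2 and N_f = 3
there are M₀ and one mass-independent regularisation `reg` with `HasMassScaling` such that for every
mass tuple with all m_f > M₀ there are species renormalisations and OS data T with `IsQCDAlong`,
non-trivial and non-Gaussian glue, non-trivial flavour-changing pseudoscalars, and one Δ > 0 with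
`T.HasMassGap Δ` and `HasLatticeMassGap Δ` (equivalent to `QCD` by ThresholdShift and trivially
implied by it). (why it might fail: it is the open problem itself (4D non-abelian gauge theory with
dynamical fermions: no continuum construction, no uniform gap in any regime).) [JaffeWitten2000,
MontvayMunster1994, OsterwalderSeiler1978]
#2 DecouplingBridge (crux) — SCALE-WISE CONSTRUCTIVE DECOUPLING (card
heavy-threshold-robust-ym-bridge K1+K2): IF SU(3) lattice Yang–Mills has a uniform lattice gap along
every N_f = 0 asymptotic-scaling trajectory (SU3YMGapAF), THEN for N_f = 2, 3 there are a threshold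
M₀ and one regularisation `reg` (two-loop `HasAsymptoticScaling` with the N_f-flavour coefficients,
`HasMassScaling`, bare masses eventually on the physical branch m_f(k) > −1) such that for all
masses above M₀ lattice QCD has `HasLatticeMassGap Δ(m)`, Δ(m) > 0 — intended proof: block RG for
gauge field + Wilson fermions from a_k to 1/M₀ with m_crit(k), Z_m(k) tuned inside the flow, then a
convergent quasi-local integration of the massive blocked quarks, leaving a small gauge-invariant
perturbation of Wilson's action on an N_f = 0 trajectory, plus stability of the Yang–Mills gap under
that perturbation (the "robust" part, which the bridge must supply itself since the hypothesis is
the plain gap). [deps: SU3YMGapAF, HeavyLatticeGap] [difficulty: XL] (why it might fail: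
block-fermion RG with a DYNAMICAL non-abelian gauge field in d=4 does not exist (BOS: external
field; Dimock: abelian d=3); bare Wilson masses are eventually NEGATIVE (m_crit ≈ −0.43g₀²):
fine-scale coercivity/sign of det D_W needs large-field bounds; gap stability is a universality
claim.) [doi:10.1103/physrevd.11.2856, doi:10.1007/bf01257414, Dimock2022QED3,
Balaban1988Convergent, Balaban1989LargeFieldII, GawedzkiKupiainenMasslessLattice1985,
MontvayMunster1994, Neuberger2000, MohlerSchaefer2020, EdwardsHellerNarayanan1998]
#3 ContinuumPackage (crux) — LATTICE HALF ⇒ FULL THRESHOLD STATEMENT (cards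
arzela-ascoli-in-the-quark-mass, quarks-add-no-infrared-clause): from the regularisation and uniform
lattice gap of HeavyLatticeGap build, for every mass tuple above the threshold and along the SAME
sequence (passing to one diagonal subsequence of `reg` serving all m, by mass-equicontinuity
supplied by the gap itself), species renormalisations z, shift and OS data T with `IsQCDAlong`
(convergence of all lattice n-point functions on ⁰𝒮: fermionic UV stability + tightness + E0'
bounds), E1 with FULL rotation invariance restored, E2–E4 closed under limits, `T.HasMassGap Δ` from
uniform clustering of the renormalised fields, and the lower bounds `IsNontrivial glue`,
`IsNonGaussian glue` (tree-level ∝ m through the ψ̄ψ-mixing of the plaquette species), `IsNontrivial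
(pseudoRe f g)` (reflection-positivity window bound: non-decoupling is an UPPER bound on the
flavoured effective mass between two short physical distances). [deps: HeavyLatticeGap, HeavyQCD]
[difficulty: XL] (why it might fail: rotation invariance (E1) of a subsequential lattice limit is
not automatic (RegularisationDichotomy) and no Ward-identity restoration is proved in 4D; UV
stability of species correlators with dynamical fermions is unproved; the gap's constants must be
uniform after k-dependent renormalisation.) [OsterwalderSchrader1975, OsterwalderSeiler1978,
Luscher1977, GlimmJaffeQP1987, Symanzik1983, JaffeWitten2000, Balaban1988Convergent,
doi:10.1007/bf01257414]
#4 SU3YMGapAF (crux) — SU(3) lattice Yang–Mills (Wilson action, fundamental representation, tree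
normalisation β = 2/g₀²) has a uniform lattice mass gap in physical units along EVERY N_f = 0
two-loop asymptotic-scaling trajectory: for every sequential scheme `sch` with β_k − afBeta 0 Λ a_k
→ 0 for some Λ > 0 there is Δ > 0 with `HasLatticeMassGap` (all gauge-invariant local observables,
all tori S ≥ L_k, uniformly in the volume). This is the lattice clause of the sibling conjunct
`YangMills` specialised to G = SU(3) with asymptotic scaling added — dimensional transmutation made
rigorous; shared with every Yang–Mills-side route. [difficulty: open-problem] (why it might fail: it
is the Yang–Mills mass gap at lattice level (Jaffe–Witten §6.5 "no present ideas point the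
direction"); the gap a·m ∝ e^{−β/(4b₀)} is invisible to every expansion in g₀
(PerturbativeInvisibility) and Bałaban's RG stops at UV stability.) [JaffeWitten2000,
ChatterjeeYMProb2019, Balaban1989LargeFieldII, Creutz2022, MagnenRivasseauSeneor1993,
Literature.MathematicalPhysics.QuantumFieldTheory.LatticeMassGapAllCouplings]
#5 HeavyLatticeGap (crux) — THE LATTICE HALF OF HEAVY QCD (junction node of the two mechanism
cruxes; stated standalone so that it can be shared, grounded and attacked directly): for N_f = 2, 3
there are a threshold M₀ and one mass-independent regularisation `reg` — two-loop
`HasAsymptoticScaling` (with `betaCoeff₀ N_f`), leading-log `HasMassScaling`, bare masses eventually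
on the physical branch m_f(k) > −1 — such that for every mass tuple above M₀ lattice QCD (Wilson
gauge action, N_f Wilson quarks, signed determinant) has a uniform lattice mass gap
`HasLatticeMassGap Δ(m)`, Δ(m) > 0: all gauge-invariant local lattice observables, all tori S ≥ L_k,
uniformly in the volume — dimensional transmutation for heavy-quark QCD at the lattice level.
[difficulty: open-problem] (why it might fail: contains the SU(3) Yang–Mills lattice gap (heavy
quarks decouple: Δ ≈ glueball mass of the N_f = 0 theory with Λ_YM = Λ(M₀/Λ)^{2N_f/33}); by the
threshold shift it is as strong as the M₀ = 0 lattice clause of QCDOf.) [JaffeWitten2000,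
OsterwalderSeiler1978, Luscher1977, MontvayMunster1994, doi:10.1103/physrevd.11.2856]
#9 ThresholdShift (support) — the threshold shift `HeavyQCD → QCD`: given M₀ and `reg`, the
regularisation `reg'` with `mcrit' k = mcrit k + a_k·max(M₀,0)/Z_m(k)` has the same `HasMassScaling`
and `reg'.scheme m = reg.scheme (m + max(M₀,0))` definitionally up to `ring`, so `QCDOf 2 ∧ QCDOf 3`
follows (the content of the audit's `qcdOf_iff_threshold`, not yet in the tree; a 15-line proof
elaborates in the planner's Sketch.lean). [difficulty: provable-now] [MontvayMunster1994,
JaffeWitten2000]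

TWO-LAYER PLAN. Foreseen glued splits (k ≤ 3, depth 1), filed only when something closes or a
definition lands:
DecouplingBridge ⇐ FermionicUVFlow (block RG a_k → 1/M₀ with m_crit, Z_m tuned in the flow; delivers
`HasMassScaling`) →
HeavySeaLocality (blocked Dirac operator coercive in block units off large fields; log det_eff = Σ_X
F(X), ‖F(X)‖ ≤ η^{|X|}) →
GapStability (N_f = 0 gap stable under gauge-invariant quasi-local perturbations of norm η at a
weak-coupling scale) → DecouplingBridge;
the Wilson-specific input of HeavySeaLocality is SPECTRAL-DEFECT EXTINCTION (card
af-entropy-vs-wilson-spectral-defects: real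
eigenvalues of D_W below the window |m_crit| − a m/Z have vanishing density per physical volume
along the trajectory) — to be typed
once `realEigenvalueCount`/`spectralDefectDensity` exist (definition request below).
ContinuumPackage ⇐ HeavyUVStability (uniform E0'-type bounds + mass-equicontinuity, card
arzela-ascoli K1/K2) → OSClosure (diagonal
subsequence, E1 rotation restoration, E2–E4, HasMassGap from uniform clustering) →
SpeciesLowerBounds (card quarks-add-no-infrared-clause
(ii)–(iii)) → ContinuumPackage.

KILL CRITERIA. A refutation of SU3YMGapAF (an asymptotic-scaling SU(3) trajectory provably WITHOUT a
uniform lattice gap) closes the route and most of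
the summit's lattice programme — close `refuted:SU3YMGapAF`. DecouplingBridge is refuted by any
mechanism by which arbitrarily heavy
Wilson quarks destroy a pure-gauge gap (e.g. a bulk first-order surface in (β, κ) that every
physical trajectory must cross for all
M₀, or sign/coercivity defects of det D_W with non-vanishing physical density at arbitrarily heavy
bare mass) — close, and hand the
witness to the af-entropy card as a barrier entry. ContinuumPackage can fail only through E1
(rotations) or the glue clauses: pivot to
flowed species (card gradient-flow-species) or raise a statement audit, do not close. A human ruling
pinning M₀ = 0 (reading (ii),
`ReachesChiralRegime`) does not refute any item but demotes the route to "heavy-quark QCD exists" —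
then supersede by a mass-transport
route (cards complex-mass-harnack-transport / sigma-fraction-gronwall-mass-transport) that uses this
one as anchor.

NOT DECOMPOSED YET. Everything inside the two implication cruxes: the block-fermion RG itself
(small/large-field split, analyticity domains of fermionic
kernels, gauge covariance of the blocked Dirac operator), the non-perturbative tuning of m_crit(k)
to o(a_kΛ) (LinearDivergenceRenormalon
forbids a series), the norm in which "robust" is measured (definition request), the ψ̄ψ-mixing
identification of the `glue` species,
the (−1)^F-twisted-trace bookkeeping on the time-periodic torus, the choice Δ = min(Δ_YM/2, …) and
the flavoured-channel rate ≥ 2M₀ − O(Λ).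
No mass transport below the threshold, no confinement, no chiral physics — not in the conjunct.

CHEAPEST FALSIFIER. (1) The abelian dry run: lattice QED₄ with N_f heavy Wilson electrons at
NEGATIVE bare Wilson mass (the same supercritical window
κ ∈ (1/8, κ_c)) should decouple to free photons by the same two steps; if block-fermion integration
à la BOS/Dimock cannot be set up
there because near-real modes of D_W survive blocking on typical (small!) fields, HeavySeaLocality
is mis-posed and DecouplingBridge
dies before any non-abelian work. (2) Data already in print: Mohler–Schaefer 2020 §4.2 report
negative strange-quark Wilson determinants
on 2% → 0.05% of CLS configurations from β = 3.4 → 3.7; a refuter should check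
EdwardsHellerNarayanan1998/PRD 60 034502 (quenched,
β_W = 5.7–6.4) for the density of real modes BELOW the window at heavier bare mass — a density flat
in β kills the fine-scale input.
(3) Lookup: any rigorous universality/stability theorem for lattice gauge-theory gaps under small
quasi-local action perturbations at
weak coupling (none found) — if one exists with hypotheses met here, rank-2 drops to the fermionic
flow alone.

NUMBERS. Tree normalisation β = 2/g₀² (= β_W/3 for SU(3)); afBeta N_f Λ a = 2b₀ log(1/(a²Λ²)) +
2(b₁/b₀) log log(1/(a²Λ²)), b₀ = (11 − 2N_f/3)/(16π²),
so a⁴ ≍ e^{−β/b₀} with 1/b₀ = 14.36 / 16.34 / 17.55 (N_f = 0/2/3). One-loop decoupling: Λ_YM =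
Λ·(M₀/Λ)^{2N_f/33}. Mass exponent
γ₀/(2β₀) = 12/29 (N_f = 2), 4/9 (N_f = 3) (`massExponent`). Critical bare mass m_crit(β) ≈ −0.434
g₀² (r = 1, one loop; MontvayMunster1994
(5.62): κ_c = ⅛(1 + 0.651/β_W·…)) so bare masses are eventually negative on every physical
trajectory; hopping expansion uniform in U
only for κ < 1/8 (HoppingExpansionLocality). Items at open: 7 (1 target, 4 cruxes — two mechanism
implications ranked 2–3 and two standalone conjecture nodes ranked 4–5 — 1 support, 1 assembly).

DEFINITION REQUESTS. - `QuasiLocalGaugePerturbation` / Bałaban-norm class of gauge-invariant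
quasi-local effective actions at scale μ (Literature/MathematicalPhysics/QuantumFieldTheory, next to
`ConstructiveQFTBalabanRG`) — needed to state GapStability (the "robust Yang–Mills" child) at all.
- `realEigenvalueCount` / `spectralDefectDensity` of the Wilson–Dirac operator along a `QCDScheme`
(Literature/MathematicalPhysics/QuantumFieldTheory next to `QCDOS`; card
af-entropy-vs-wilson-spectral-defects D1) — needed to type spectral-defect extinction as the
Wilson-specific child of DecouplingBridge.
- cite fact wanted: Lüscher's positive transfer matrix for Wilson fermions (Luscher1977) as a named
Literature fact over `qcdTorusExpect` (used by ContinuumPackage and by the statement's own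
docstring).

Novelty: Searches (2026-08-15): `lit frontier QuantumFields --since 2020` (30 rows: YM–Higgs scaling limits
arXiv:2401.10507, stochastic
quantisation, no fermionic constructions); `lit bridges QuantumFields --cross any`
(CriticalPhenomena overlaps only); `lit search
"negative real eigenvalues Wilson Dirac operator determinant sign continuum limit"` (local 10 +
remote 15: doi:10.1103/physrevd.60.034502
EHN 1999 quenched H_W continuum approach, MohlerSchaefer-type sign studies, no rigorous work); `lit
galaxy search --star all` for
"Appelquist-Carazzone" (12 rows, textbooks), "decoupling theorem" (13, EFT texts), "femto-universe"
(6), "step scaling function"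
(12, ALPHA numerics), "Wilson fermions reflection positivity" (0); the spine card's own
crossref/zbMATH searches and the refuter
novelty audit of 2026-08-15 (perturbative decoupling only: Ball–Thorne doi:10.1006/aphy.1995.1067,
Kopper flow equations
doi:10.1007/978-3-7643-7434-1_12). searchd was intermittently unavailable (rc 75) during the
session.
Nearest prior art found: doi:10.1103/physrevd.11.2856 (Appelquist–Carazzone, perturbative
decoupling); doi:10.1007/bf01257414
(Bałaban–O'Carroll–Schor block RG for fermions in EXTERNAL gauge fields) and Dimock2022QED3
(dynamical but abelian, d = 3);
Balaban1989LargeFieldII (pure-gauge UV stability in d = 4). No non-perturbative decoupling theorem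
reducing lattice-QCD existence to a
quasi-locally perturbed pure-gauge measure exists, and no prior use of the statement-level mass
threshold.
D  [refs: 10.1103/physrevd.60.034502, 10.1006/aphy.1995.1067, 10.1007/978-3-7643-7434-1_12, 10.1103/physrevd.11.2856, 10.1007/bf01257414, 2401.10507, doi:10.1103/physrevd.60.034502, doi:10.1006/aphy.1995.1067, doi:10.1007/978-3-7643-7434-1_12, doi:10.1103/physrevd.11.2856, doi:10.1007/bf01257414]

Barriers (technique_class: heavy-threshold-decoupling, block-rg-fermions, robust-ym): - technique_class: heavy-threshold-decoupling, block-rg-fermions, robust-ym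
- Literature.Barriers.QuantumFields.HoppingExpansionUniformGap: evaded by scale — the
random-walk/heavy expansion is run on the BLOCK lattice of spacing ~1/M₀ where the quark mass is
O(1) in current units (inside the disc), never on the fine lattice where κ → κ_c > 1/8.
- Literature.Barriers.QuantumFields.HoppingExpansionLocality: same evasion; the fine-lattice
propagator is never expanded in κ.
- Literature.Barriers.QuantumFields.LinearDivergenceRenormalon: m_crit(k) is tuned
non-perturbatively inside the flow (shooting/implicit-function argument per scale), not by a
Borel-summed series — the barrier's own recorded evasion.
- Literature.Barriers.QuantumFields.UVStabilityNonUniqueness: conceded and harmless — the statement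
is sequential (ruling Y2); ContinuumPackage uses compactness + mass-equicontinuity (one diagonal
subsequence for all m) and proves the axioms and the gap of the limit, which is what Jaffe–Witten
fn. 2 asks of a compactness construction.
- Literature.Barriers.QuantumFields.PerturbativeInvisibility: respected — no gap is extracted from
perturbation theory; Δ comes from SU3YMGapAF; perturbation theory is used only at the scale M₀ ≫ Λ
(non-decoupling, matching), where g(M₀) is an honest small parameter.
- Literature.Barriers.QuantumFields.RegularisationDichotomy: it does not evade it; the bet is that
E1 (rotations) can be restored in the limit for gauge-invariant correlators (ContinuumP

History (route lifecycle, newest last):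
- 2026-08-15T14:02:08Z · CLOSED superseded — superseded:route-QuantumFields-HeavyThresholdYMBridge (planner-plan-QuantumFields-QCD-0)

sub-problem: QCD · status: closed(superseded) · opened planner-plan-QuantumFields-QCD-0 2026-08-15T13:35:08Z · rev 0 · ledger route-QuantumFields-HeavyThresholdBridge
GENERATED by the gate from the ledger (D-0016/17). Provers cite these decls: `theorem foo : Summit.QuantumFields.QCD.Theses.HeavyThresholdBridge.<Decl> := …` in Summits/QuantumFields/QCD/Theorems/<Name>.lean.
-/

namespace Summit.QuantumFields.QCD.Theses.HeavyThresholdBridge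

open scoped BigOperators Topology Manifold Classical MeasureTheory ProbabilityTheory Matrix InnerProductSpace ComplexConjugate ContinuousMap
open Filter Set Function TopologicalSpace MeasureTheory

attribute [summit_statement] _root_.QCD

/-- item stmt-QuantumFields-8832 · target · rank 0 · closed · moot by None · by planner
why it might fail: it is the open problem itself (4D non-abelian gauge theory with dynamical fermions: no continuum construction, no uniform gap in any regime).
sources: JaffeWitten2000, MontvayMunster1994, OsterwalderSeiler1978
[target] the threshold form of the conjunct: for N_f = 2 and N_f = 3 there are M₀ and one
mass-independent regularisation `reg` with `HasMassScaling` such that for every mass tuple with all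
m_f > M₀ there are species renormalisations and OS data T with `IsQCDAlong`, non-trivial and
non-Gaussian glue, non-trivial flavour-changing pseudoscalars, and one Δ > 0 with `T.HasMassGap Δ`
and `HasLatticeMassGap Δ` (equivalent to `QCD` by ThresholdShift and trivially implied by it). -/
@[route_item "route-QuantumFields-HeavyThresholdBridge"]
def HeavyQCD : Prop :=
  ∀ Nf : ℕ, Nf = 2 ∨ Nf = 3 → ∃ M₀ : ℝ, ∃ reg : Literature.MathematicalPhysics.QuantumFieldTheory.QCDRegularisation Nf, reg.HasMassScaling ∧ ∀ m : Fin Nf → ℝ, (∀ f, M₀ < m f) → ∃ (z shift : Literature.MathematicalPhysics.QuantumFieldTheory.QCDField Nf → ℕ → ℝ) (T : Literature.MathematicalPhysics.QuantumFieldTheory.OSData (Literature.MathematicalPhysics.QuantumFieldTheory.QCDField Nf) 4), Literature.MathematicalPhysics.QuantumFieldTheory.IsQCDAlong (reg.scheme m z shift) T ∧ T.IsNontrivial Literature.MathematicalPhysics.QuantumFieldTheory.QCDField.glue ∧ T.IsNonGaussian Literature.MathematicalPhysics.QuantumFieldTheory.QCDField.glue ∧ (∀ f g : Fin Nf, f ≠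 g → T.IsNontrivial (Literature.MathematicalPhysics.QuantumFieldTheory.QCDField.pseudoRe f g)) ∧ ∃ Δ > 0, T.HasMassGap Δ ∧ (reg.scheme m z shift).HasLatticeMassGap Δ

-- TODO item stmt-QuantumFields-8835 · crux · rank 2 · closed · moot by None · by planner — BLOCKED: missing decl(s) HeavyLatticeGap, SU3YMGapAF; restate via `ledger route edit` once they land:
--   def DecouplingBridge : Prop := SU3YMGapAF → HeavyLatticeGap

-- TODO item stmt-QuantumFields-8836 · crux · rank 3 · closed · moot by None · by planner — BLOCKED: missing decl(s) HeavyLatticeGap; restate via `ledger route edit` once they land: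
--   def ContinuumPackage : Prop := HeavyLatticeGap → HeavyQCD

/-- item stmt-QuantumFields-8833 · crux · rank 4 · closed · moot by None · by planner
why it might fail: it is the Yang–Mills mass gap at lattice level (Jaffe–Witten §6.5 "no present ideas point the direction"); the gap a·m ∝ e^{−β/(4b₀)} is invisible to every expansion in g₀ (PerturbativeInvisibility) and Bałaban's RG stops at UV stability.
sources: JaffeWitten2000, ChatterjeeYMProb2019, Balaban1989LargeFieldII, Creutz2022, MagnenRivasseauSeneor1993, Literature.MathematicalPhysics.QuantumFieldTheory.LatticeMassGapAllCouplings
[crux] SU(3) lattice Yang–Mills (Wilson action, fundamental representation, tree normalisation β =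
2/g₀²) has a uniform lattice mass gap in physical units along EVERY N_f = 0 two-loop
asymptotic-scaling trajectory: for every sequential scheme `sch` with β_k − afBeta 0 Λ a_k → 0 for
some Λ > 0 there is Δ > 0 with `HasLatticeMassGap` (all gauge-invariant local observables, all tori
S ≥ L_k, uniformly in the volume). This is the lattice clause of the sibling conjunct `YangMills`
specialised to G = SU(3) with asymptotic scaling added — dimensional transmutation made rigorous;
shared with every Yang–Mills-side route. [difficulty: open-problem] -/
@[route_item "route-QuantumFields-HeavyThresholdBridge"]
def SU3YMGapAF : Prop :=
  ∀ sch : Literature.MathematicalPhysics.QuantumFieldTheory.SpeciesScheme (Literature.MathematicalPhysics.QuantumFieldTheory.YMSpecies (Matrix.specialUnitaryGroup (Fin 3) ℂ)), (∃ Λ > 0, Filter.Tendsto (fun k => sch.β k - Literature.MathematicalPhysics.QuantumFieldTheory.afBeta 0 Λ (sch.a k)) Filter.atTop (𝓝 0)) → ∃ Δ > 0, Literature.MathematicalPhysics.QuantumFieldTheory.HasLatticeMassGap (⟨3, Literature.MathematicalPhysics.QuantumLattice.fundamentalRep (Fin 3), Literature.MathematicalPhysics.QuantumLattice.continuous_fundamentalRep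 _, Literature.MathematicalPhysics.QuantumLattice.fundamentalRep_injective _, Literature.MathematicalPhysics.QuantumLattice.fundamentalRep_mem_unitaryGroup⟩ : Literature.MathematicalPhysics.QuantumFieldTheory.LatticeRep (Matrix.specialUnitaryGroup (Fin 3) ℂ)) sch Δ

/-- item stmt-QuantumFields-8834 · crux · rank 5 · closed · moot by None · by planner
why it might fail: contains the SU(3) Yang–Mills lattice gap (heavy quarks decouple: Δ ≈ glueball mass of the N_f = 0 theory with Λ_YM = Λ(M₀/Λ)^{2N_f/33}); by the threshold shift it is as strong as the M₀ = 0 lattice clause of QCDOf.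
sources: JaffeWitten2000, OsterwalderSeiler1978, Luscher1977, MontvayMunster1994, doi:10.1103/physrevd.11.2856
[crux] THE LATTICE HALF OF HEAVY QCD (junction node of the two mechanism cruxes; stated standalone
so that it can be shared, grounded and attacked directly): for N_f = 2, 3 there are a threshold M₀
and one mass-independent regularisation `reg` — two-loop `HasAsymptoticScaling` (with `betaCoeff₀
N_f`), leading-log `HasMassScaling`, bare masses eventually on the physical branch m_f(k) > −1 —
such that for every mass tuple above M₀ lattice QCD (Wilson gauge action, N_f Wilson quarks, signed
determinant) has a uniform lattice mass gap `HasLatticeMassGap Δ(m)`, Δ(m) > 0: all gauge-invariant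
local lattice observables, all tori S ≥ L_k, uniformly in the volume — dimensional transmutation for
heavy-quark QCD at the lattice level. [difficulty: open-problem] -/
@[route_item "route-QuantumFields-HeavyThresholdBridge"]
def HeavyLatticeGap : Prop :=
  ∀ Nf : ℕ, Nf = 2 ∨ Nf = 3 → ∃ M₀ : ℝ, ∃ reg : Literature.MathematicalPhysics.QuantumFieldTheory.QCDRegularisation Nf, reg.HasMassScaling ∧ (reg.scheme 0 0 0).HasAsymptoticScaling ∧ ∀ m : Fin Nf → ℝ, (∀ f, M₀ < m f) → (∀ f, ∀ᶠ k in Filter.atTop, -1 < (reg.scheme m 0 0).mq f k) ∧ ∃ Δ > 0, (reg.scheme m 0 0).HasLatticeMassGap Δ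

/-- item stmt-QuantumFields-8837 · support · rank 9 · closed · moot by None · by planner
sources: MontvayMunster1994, JaffeWitten2000
[support] the threshold shift `HeavyQCD → QCD`: given M₀ and `reg`, the regularisation `reg'` with
`mcrit' k = mcrit k + a_k·max(M₀,0)/Z_m(k)` has the same `HasMassScaling` and `reg'.scheme m =
reg.scheme (m + max(M₀,0))` definitionally up to `ring`, so `QCDOf 2 ∧ QCDOf 3` follows (the content
of the audit's `qcdOf_iff_threshold`, not yet in the tree; a 15-line proof elaborates in the
planner's Sketch.lean). [difficulty: provable-now] -/
@[route_item "route-QuantumFields-HeavyThresholdBridge"]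
def ThresholdShift : Prop :=
  HeavyQCD → QCD

-- TODO item stmt-QuantumFields-8838 · assembly · rank 1 · closed · moot by None · by planner — BLOCKED: missing decl(s) ContinuumPackage, DecouplingBridge; restate via `ledger route edit` once they land:
--   def Assembly : Prop := SU3YMGapAF → DecouplingBridge → ContinuumPackage → ThresholdShift → QCD

end Summit.QuantumFields.QCD.Theses.HeavyThresholdBridge
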